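import Summits.BirchSwinnertonDyer.BirchSwinnertonDyer.Theorems.BiquadraticEisensteinDescentManinDatumSupercuspidalCMInertResolventCertificateJZero
import Summits.BirchSwinnertonDyer.BirchSwinnertonDyer.Theorems.BiquadraticEisensteinDescentManinDatumSupercuspidalCMInertThetaValueAssembly
import Literature.NumberTheory.EllipticCurves.QuadraticOrderThreeEisensteinLattice
import HarnessLib

set_option linter.dupNamespace false -- `Summit.BirchSwinnertonDyer.BirchSwinnertonDyer.Theorems.…` (summit = sub, D-0017)
set_option autoImplicit false

/-!
# Crux `ManinDatumSupercuspidalCMInert` (stmt-BirchSwinnertonDyer-20111, BED r605), stub `stub_S5` (`j = 0` at `p = 5`) — ASSEMBLY LANE,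
# `j = 0` twin of `…ThetaValueAssembly` §§1–3: the finite Eisenstein–Kronecker sum of `𝒪₃ = ℤω₃ + ℤ` modulo `5M′` with weight `Φ ⊗ Ψ`
# (`Φ` on `𝒪₃/5` with the axioms of `(·/5)₆^k`, `Ψ` modulo `M′`) is `5`-integral after division by `ϖ₁ · 5^{(6−k)/6}`
# (width seat `bsd-wall-cm-bed-w3` g11; theorems only; `--supports 20111`, helper)

Route `BiquadraticEisensteinDescent` (cell `pub/bsd-wall`), S5-road item D4: the CRT / lattice / torsion-sum bookkeeping between the E-side
finite formula `QuadOrder.thetaLFunction_parityLift_one` (`Θ-L(1) = (2M)⁻¹ Σ_{d mod M} W(d) E₁((d₁ + d₂ω₃)/M; 𝒪₃)`, fed by bed-w2 g11's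
sextic-twist dictionary with `M = 5M′`, `W(y) = Φ(y₂, y₁ + y₂)·Ψ(y)` — `y₁ + y₂ω₃ = y₂ρ + (y₁ + y₂)`, so `Φ` is read in bed-w1 g8's
coordinates `d₁ρ + d₂`) and the CM core ★★ `…ResolventCertificateJZero.core_rho_of_character` (bed-w1 g8, p646856, PROVED: for `Φ : (ℤ/5)² → ℂ`
with `Φ 0 = 0`, `Φ(0,1) = 1`, `Φ(−d) = Φ d`, `Φ(ρd) = ρ^kΦ(d)`, `Φ((1−ρ)d) = (−ρ²)^kΦ(d)`, `1 ≤ k ≤ 5`, `(M′, 5) = 1`, `M′w ∈ Λ = ℤρ + ℤ`: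
`s·(Σ_d Φ(d)E₁(w − t_d; Λ))/(ϖ₁·5^{(6−k)/6}) ∈ ℤ̄`, `5 ∤ s`, `t_d = (d₁ρ + d₂)/5`). The lattice identification `𝒪₃ = ℤρ + ℤ` is bed-w1 g8's
`Literature/…/QuadraticOrderThreeEisensteinLattice` (p648077).

* §1 `phi_three_mul`, `phi_units_mul` — the axioms force `Φ(u·d) = Φ(d)` for every unit `u ∈ (ℤ/5)ˣ` (`(1−ρ)² = −3ρ`, `ρ³ = 1`);
* §2 `exists_int_crt_five`, `eisensteinE₁_divPoint_eq_of_coprime`, `apply_natCast_eq_of_periodic` — CRT for a representative modulo `5M′`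
  (`αM′ + 5β = 1`): `E₁((c₁ + c₂ω₃)/(5M′)) = E₁(β(b₁ + b₂ω₃)/M′ + α(a₁ + a₂ω₃)/5)` (`a = c mod 5`, `b = c mod M′`);
* §3 `fivePart_add_divPointRho_mem`, `sum_five_eq_coreSum` — `α(a₁ + a₂ω₃)/5 ≡ −t_d (mod Λ)`, `d = γ·(a₂, a₁ + a₂)`, `γ ≡ −α`, and the inner
  sum over `𝒪₃/5` IS the core sum `Σ_d Φ(d)E₁(w − t_d)` (linear reindexing, `Φ(γ·x) = Φ(x)`);
* §4 `sum_classes_eq_sum_coreSum` — `Σ_{c mod 5M′} W(c)E₁((c₁ + c₂ω₃)/(5M′); 𝒪₃) = Σ_{b mod M′} Ψ(b) · CoreSum(β(b₁ + b₂ω₃)/M′)`;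
* §5 ★ `sum_classes_integral_of_character` — `∃ s, 5 ∤ s ∧ s·(Σ_{c mod 5M′} W(c)E₁((c₁ + c₂ω₃)/(5M′); 𝒪₃))/(ϖ₁·5^{(6−k)/6}) ∈ ℤ̄`
  (`Ψ` periodic modulo `M′` with algebraic-integer values) — the input of the `L`-value assembly `…ModelLValuesSexticOfDictionary`.

HONEST FRAMING: nothing here proves the sextic dictionary (bed-w2 g11), the stub, the crux, Manin's conjecture or BSD. No definition, no
named fact, no `sorry`; axioms standard. [cite: Rubin1999, §7.4 Prop. 7.12, Prop. 7.15] [cite: Serre1979, Ch. IV §2 Prop. 7]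
-/

noncomputable section

open scoped Classical
open Complex PeriodPair
open Literature.NumberTheory.EllipticCurves
open Literature.NumberTheory.LFunctions

namespace Summit.BirchSwinnertonDyer.BirchSwinnertonDyer.Theorems.BiquadraticEisensteinDescentManinDatumSupercuspidalCMInertThetaValueAssemblyJZero

open Summit.BirchSwinnertonDyer.BirchSwinnertonDyer.Theorems.BiquadraticEisensteinDescentManinDatumSupercuspidalCMInertThetaValueAssembly
  (sum_integral_of_termwise)
open Summit.BirchSwinnertonDyer.BirchSwinnertonDyer.Theorems.BiquadraticEisensteinDescentManinDatumSupercuspidalCMInertResolventCertificateJZero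
  (core_rho_of_character)
open Summit.BirchSwinnertonDyer.BirchSwinnertonDyer.Theorems.BiquadraticEisensteinDescentManinDatumSupercuspidalCMInertResolventBoundReductionJZero
  (rho_pow_eq_one_iff)

/-! ## §0 `𝒪₃ = ℤω₃ + ℤ = ℤρ + ℤ` (bed-w1 g8's `QuadOrder.omega_three` / `periodPair_three_lattice_eq` / `eisensteinE₁_periodPair_three`) -/

/-- `m + nω₃ ∈ ℤρ + ℤ`. [folklore] -/
theorem intCast_add_intCast_mul_omega_mem (m n : ℤ) :
    (m : ℂ) + (n : ℂ) * QuadOrder.omega 3 ∈ (ofUpperHalfPlane UpperHalfPlane.ρ).lattice := by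
  rw [EisensteinLattice.mem_lattice_iff, QuadOrder.omega_three]
  exact ⟨n, m + n, by push_cast; ring⟩

/-! ## §1 The axioms of `(·/5)₆^k` force invariance under the rational units modulo `5` -/

section Phi

variable {k : ℕ} (Φ : ZMod 5 × ZMod 5 → ℂ) (hΦneg : ∀ d, Φ (-d) = Φ d)
  (hΦrho : ∀ d : ZMod 5 × ZMod 5, Φ (d.2 - d.1, -d.1) = (UpperHalfPlane.ρ : ℂ) ^ k * Φ d)
  (hΦgen : ∀ d : ZMod 5 × ZMod 5, Φ (2 * d.1 - d.2, d.1 + d.2) = (-(UpperHalfPlane.ρ : ℂ) ^ 2) ^ k * Φ d)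
include hΦneg hΦrho hΦgen

/-- **`Φ(3d) = Φ(d)`**: `(1 − ρ)² = −3ρ`, so `((1−ρ)/5)₆² = (−ρ²)^{2} ≡ ρ·(3/5)₆·(−1/5)₆`, i.e. `ρ^{4k}Φ(d) = ρ^kΦ(3d)` and `ρ³ = 1`.
[cite: IrelandRosen1982, Ch. 9 §3] -/
theorem phi_three_mul (d : ZMod 5 × ZMod 5) : Φ (3 * d.1, 3 * d.2) = Φ d := by
  -- `(1−ρ)²·d` in coordinates: apply the generator axiom twice
  have h1 : Φ (2 * (2 * d.1 - d.2) - (d.1 + d.2), (2 * d.1 - d.2) + (d.1 + d.2)) =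
      ((-(UpperHalfPlane.ρ : ℂ) ^ 2) ^ k) ^ 2 * Φ d := by
    have h := hΦgen (2 * d.1 - d.2, d.1 + d.2)
    simp only at h
    rw [h, hΦgen d]; ring
  -- the same point is `−ρ·(3d)`
  have e : ((2 * (2 * d.1 - d.2) - (d.1 + d.2), (2 * d.1 - d.2) + (d.1 + d.2)) : ZMod 5 × ZMod 5) =
      -(((3 * d.2 - 3 * d.1, -(3 * d.1)) : ZMod 5 × ZMod 5)) := by
    ext <;> simp only [Prod.neg_mk] <;> ring
  have h2 : Φ (-(((3 * d.2 - 3 * d.1, -(3 * d.1)) : ZMod 5 × ZMod 5))) = (UpperHalfPlane.ρ : ℂ) ^ k * Φ (3 * d.1, 3 * d.2) := by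
    rw [hΦneg]
    have h := hΦrho (3 * d.1, 3 * d.2)
    simp only at h
    exact h
  rw [e, h2] at h1
  -- `((-ρ²)^k)² = ρ^{4k} = ρ^k`
  have hρ3 : (UpperHalfPlane.ρ : ℂ) ^ 3 = 1 := (rho_pow_eq_one_iff 3).mpr (dvd_refl 3)
  have hρ4 : (-(UpperHalfPlane.ρ : ℂ) ^ 2) ^ 2 = UpperHalfPlane.ρ := by
    rw [neg_sq, ← pow_mul, show 2 * 2 = 3 + 1 from rfl, pow_add, hρ3, one_mul, pow_one]
  have hsq : ((-(UpperHalfPlane.ρ : ℂ) ^ 2) ^ k) ^ 2 = (UpperHalfPlane.ρ : ℂ) ^ k := by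
    rw [← pow_mul, mul_comm, pow_mul, hρ4]
  rw [hsq] at h1
  have hρ0 : (UpperHalfPlane.ρ : ℂ) ^ k ≠ 0 := pow_ne_zero _ (UpperHalfPlane.ne_zero _)
  exact mul_left_cancel₀ hρ0 h1

/-- **`Φ(u·d) = Φ(d)` for every unit `u` of `ℤ/5`** (`3` generates `(ℤ/5)ˣ`: `2 = 3³`, `4 = 3²`, `1 = 3⁴`; equivalently
`(u/5)₆ = u^{(25−1)/6} = u⁴ = 1` for rational `u`). [cite: IrelandRosen1982, Ch. 9 §3] -/
theorem phi_units_mul (u : ZMod 5) (hu : u ≠ 0) (d : ZMod 5 × ZMod 5) : Φ (u * d.1, u * d.2) = Φ d := by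
  have h3 : ∀ x : ZMod 5 × ZMod 5, Φ (3 * x.1, 3 * x.2) = Φ x := phi_three_mul Φ hΦneg hΦrho hΦgen
  have h9 : ∀ x : ZMod 5 × ZMod 5, Φ (3 * 3 * x.1, 3 * 3 * x.2) = Φ x := fun x ↦ by
    have h := h3 (3 * x.1, 3 * x.2)
    simp only [← mul_assoc] at h
    rw [h, h3]
  have h27 : ∀ x : ZMod 5 × ZMod 5, Φ (3 * 3 * 3 * x.1, 3 * 3 * 3 * x.2) = Φ x := fun x ↦ by
    have h := h3 (3 * 3 * x.1, 3 * 3 * x.2)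
    simp only [← mul_assoc] at h
    rw [h, h9]
  have h81 : ∀ x : ZMod 5 × ZMod 5, Φ (3 * 3 * 3 * 3 * x.1, 3 * 3 * 3 * 3 * x.2) = Φ x := fun x ↦ by
    have h := h3 (3 * 3 * 3 * x.1, 3 * 3 * 3 * x.2)
    simp only [← mul_assoc] at h
    rw [h, h27]
  have key : ∀ v : ZMod 5, v ≠ 0 → v = 3 ∨ v = 3 * 3 ∨ v = 3 * 3 * 3 ∨ v = 3 * 3 * 3 * 3 := by decide
  rcases key u hu with rfl | rfl | rfl | rfl
  · exact h3 d
  · exact h9 d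
  · exact h27 d
  · exact h81 d

end Phi

/-! ## §2 Chinese remainder modulo `5M′` for the division points of `𝒪₃` -/

section CRT

variable {M' : ℕ}

/-- **Integer CRT decomposition**: with `αM′ + 5β = 1`, every natural `X` is `αM′·(X mod 5) + 5β·(X mod M′)` modulo `5M′`
(canonical representatives). [folklore] -/
theorem exists_int_crt_five {α β : ℤ} (hαβ : α * M' + 5 * β = 1) (X : ℕ) :
    ∃ z : ℤ, (X : ℤ) = α * M' * (((X : ZMod 5).val : ℕ) : ℤ) + 5 * β * (((X : ZMod M').val : ℕ) : ℤ) + (5 * M' : ℕ) * z := by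
  have hcopZ : IsCoprime (5 : ℤ) (M' : ℤ) := by
    refine ⟨β, α, by linear_combination hαβ⟩
  rw [ZMod.val_natCast, ZMod.val_natCast]
  have hdq : (5 : ℤ) ∣ (X : ℤ) - α * M' * ((X % 5 : ℕ) : ℤ) - 5 * β * ((X % M' : ℕ) : ℤ) := by
    refine ⟨(X / 5 : ℕ) + β * ((X % 5 : ℕ) : ℤ) - β * ((X % M' : ℕ) : ℤ), ?_⟩
    have hX : ((X : ℕ) : ℤ) = 5 * ((X / 5 : ℕ) : ℤ) + ((X % 5 : ℕ) : ℤ) := by exact_mod_cast (Nat.div_add_mod X 5).symm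
    linear_combination hX - (((X % 5 : ℕ) : ℤ)) * hαβ
  have hdM : (M' : ℤ) ∣ (X : ℤ) - α * M' * ((X % 5 : ℕ) : ℤ) - 5 * β * ((X % M' : ℕ) : ℤ) := by
    refine ⟨(X / M' : ℕ) - α * ((X % 5 : ℕ) : ℤ) + α * ((X % M' : ℕ) : ℤ), ?_⟩
    have hX : ((X : ℕ) : ℤ) = M' * ((X / M' : ℕ) : ℤ) + ((X % M' : ℕ) : ℤ) := by exact_mod_cast (Nat.div_add_mod X M').symm
    linear_combination hX - (((X % M' : ℕ) : ℤ)) * hαβ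
  obtain ⟨z, hz⟩ := hcopZ.mul_dvd hdq hdM
  refine ⟨z, ?_⟩
  have hqM : ((5 * M' : ℕ) : ℤ) = (5 : ℤ) * (M' : ℤ) := by push_cast; ring
  rw [hqM]
  linear_combination hz

variable [NeZero M']

/-- **The Eisenstein number of a class modulo `5M′` splits along CRT** (`E₁` is `𝒪₃`-periodic, `𝒪₃ = ℤρ + ℤ`): with `αM′ + 5β = 1`,
`E₁((c₁ + c₂ω₃)/(5M′); ℤρ + ℤ) = E₁(β(b₁ + b₂ω₃)/M′ + α(a₁ + a₂ω₃)/5; ℤρ + ℤ)` (`a = c mod 5`, `b = c mod M′`, canonical representatives).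
[folklore] -/
theorem eisensteinE₁_divPoint_eq_of_coprime {α β : ℤ} (hαβ : α * M' + 5 * β = 1) (c : ZMod (5 * M') × ZMod (5 * M')) :
    (ofUpperHalfPlane UpperHalfPlane.ρ).eisensteinE₁ (QuadOrder.divPoint 3 (5 * M') c) =
      (ofUpperHalfPlane UpperHalfPlane.ρ).eisensteinE₁
        ((β : ℂ) * ((((c.1.val : ZMod M').val : ℕ) : ℂ) + (((c.2.val : ZMod M').val : ℕ) : ℂ) * QuadOrder.omega 3) / M' +
          (α : ℂ) * ((((c.1.val : ZMod 5).val : ℕ) : ℂ) + (((c.2.val : ZMod 5).val : ℕ) : ℂ) * QuadOrder.omega 3) / 5) := by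
  obtain ⟨z₁, hz₁⟩ := exists_int_crt_five hαβ c.1.val
  obtain ⟨z₂, hz₂⟩ := exists_int_crt_five hαβ c.2.val
  have hM : (M' : ℂ) ≠ 0 := Nat.cast_ne_zero.mpr (NeZero.ne M')
  have h1 : ((c.1.val : ℕ) : ℂ) = (α : ℂ) * M' * (((c.1.val : ZMod 5).val : ℕ) : ℂ) +
      5 * (β : ℂ) * (((c.1.val : ZMod M').val : ℕ) : ℂ) + ((5 * M' : ℕ) : ℂ) * (z₁ : ℂ) := by exact_mod_cast hz₁
  have h2 : ((c.2.val : ℕ) : ℂ) = (α : ℂ) * M' * (((c.2.val : ZMod 5).val : ℕ) : ℂ) +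
      5 * (β : ℂ) * (((c.2.val : ZMod M').val : ℕ) : ℂ) + ((5 * M' : ℕ) : ℂ) * (z₂ : ℂ) := by exact_mod_cast hz₂
  have e : QuadOrder.divPoint 3 (5 * M') c =
      ((β : ℂ) * ((((c.1.val : ZMod M').val : ℕ) : ℂ) + (((c.2.val : ZMod M').val : ℕ) : ℂ) * QuadOrder.omega 3) / M' +
          (α : ℂ) * ((((c.1.val : ZMod 5).val : ℕ) : ℂ) + (((c.2.val : ZMod 5).val : ℕ) : ℂ) * QuadOrder.omega 3) / 5) +
        ((z₁ : ℂ) + (z₂ : ℂ) * QuadOrder.omega 3) := by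
    rw [QuadOrder.divPoint, h1, h2]
    push_cast
    field_simp
    ring
  rw [e, eisensteinE₁_add_of_mem_lattice _ (intCast_add_intCast_mul_omega_mem z₁ z₂)]

omit [NeZero M'] in
/-- A function on `ℤ²` periodic modulo `M′` takes the same value at `(c₁, c₂)` and at the canonical representatives of
`(c₁ mod M′, c₂ mod M′)`. [folklore] -/
theorem apply_natCast_eq_of_periodic (Ψ : ℤ × ℤ → ℂ) (hΨ : ∀ y z : ℤ × ℤ, Ψ (y.1 + M' * z.1, y.2 + M' * z.2) = Ψ y)
    (X Y : ℕ) : Ψ ((X : ℤ), (Y : ℤ)) = Ψ ((((X : ZMod M').val : ℕ) : ℤ), (((Y : ZMod M').val : ℕ) : ℤ)) := by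
  rw [ZMod.val_natCast, ZMod.val_natCast]
  have hX : ((X : ℕ) : ℤ) = ((X % M' : ℕ) : ℤ) + M' * ((X / M' : ℕ) : ℤ) := by exact_mod_cast (Nat.mod_add_div X M').symm
  have hY : ((Y : ℕ) : ℤ) = ((Y % M' : ℕ) : ℤ) + M' * ((Y / M' : ℕ) : ℤ) := by exact_mod_cast (Nat.mod_add_div Y M').symm
  have h := hΨ (((X % M' : ℕ) : ℤ), ((Y % M' : ℕ) : ℤ)) (((X / M' : ℕ) : ℤ), ((Y / M' : ℕ) : ℤ))
  simp only at h
  rw [hX, hY, h]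

end CRT

/-! ## §3 The `5`-part of a division point is a `5`-division point `t_d` of `ℤρ + ℤ`, and the inner sum is the core sum -/

section Five

/-- **`α(a₁ + a₂ω₃)/5 + t_d ∈ Λ`** for `d = γ·(a₂, a₁ + a₂) ∈ (ℤ/5)²`, `γ ≡ −α (mod 5)` (`ω₃ = ρ + 1`; `t_d = (d₁ρ + d₂)/5` with canonical
representatives). [folklore] -/
theorem fivePart_add_divPointRho_mem (α : ℤ) (γ : ZMod 5) (hγ : (α : ZMod 5) + γ = 0) (a : ZMod 5 × ZMod 5) :
    (α : ℂ) * (((a.1.val : ℕ) : ℂ) + ((a.2.val : ℕ) : ℂ) * QuadOrder.omega 3) / 5 +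
        ((((γ * a.2).val : ℂ) * UpperHalfPlane.ρ + (((γ * (a.1 + a.2)).val : ℂ))) / 5) ∈
      (ofUpperHalfPlane UpperHalfPlane.ρ).lattice := by
  -- both coordinates of the numerator are divisible by `5`
  have h1 : ((α * (a.2.val : ℕ) + ((γ * a.2).val : ℕ) : ℤ) : ZMod 5) = 0 := by
    push_cast
    rw [ZMod.natCast_zmod_val, ZMod.natCast_zmod_val]
    linear_combination a.2 * hγ
  have h2 : ((α * ((a.1.val : ℕ) + (a.2.val : ℕ)) + ((γ * (a.1 + a.2)).val : ℕ) : ℤ) : ZMod 5) = 0 := by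
    push_cast
    rw [ZMod.natCast_zmod_val, ZMod.natCast_zmod_val, ZMod.natCast_zmod_val]
    linear_combination (a.1 + a.2) * hγ
  obtain ⟨m, hm⟩ := (ZMod.intCast_zmod_eq_zero_iff_dvd _ 5).mp h1
  obtain ⟨n, hn⟩ := (ZMod.intCast_zmod_eq_zero_iff_dvd _ 5).mp h2
  rw [EisensteinLattice.mem_lattice_iff, QuadOrder.omega_three]
  refine ⟨m, n, ?_⟩
  have hmC : (α : ℂ) * ((a.2.val : ℕ) : ℂ) + (((γ * a.2).val : ℕ) : ℂ) = 5 * (m : ℂ) := by exact_mod_cast hm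
  have hnC : (α : ℂ) * (((a.1.val : ℕ) : ℂ) + ((a.2.val : ℕ) : ℂ)) + (((γ * (a.1 + a.2)).val : ℕ) : ℂ) = 5 * (n : ℂ) := by
    exact_mod_cast hn
  rw [← add_div, eq_div_iff (by norm_num : (5 : ℂ) ≠ 0)]
  linear_combination (-((UpperHalfPlane.ρ : UpperHalfPlane) : ℂ)) * hmC - hnC

variable {k : ℕ} (Φ : ZMod 5 × ZMod 5 → ℂ) (hΦneg : ∀ d, Φ (-d) = Φ d)
  (hΦrho : ∀ d : ZMod 5 × ZMod 5, Φ (d.2 - d.1, -d.1) = (UpperHalfPlane.ρ : ℂ) ^ k * Φ d)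
  (hΦgen : ∀ d : ZMod 5 × ZMod 5, Φ (2 * d.1 - d.2, d.1 + d.2) = (-(UpperHalfPlane.ρ : ℂ) ^ 2) ^ k * Φ d)
include hΦneg hΦrho hΦgen

/-- **The inner sum over `𝒪₃/5` is the core sum.** For `α` prime to `5` and any `w`:
`Σ_{a mod 5} Φ(a₂, a₁ + a₂) E₁(w + α(a₁ + a₂ω₃)/5) = Σ_{d} Φ(d) E₁(w − t_d)` — reindex by the linear bijection `a ↦ d = γ·(a₂, a₁ + a₂)`
of `(ℤ/5)²`, `γ ≡ −α (mod 5)` (`Φ(γ·x) = Φ(x)`, §1) and use `α(a₁ + a₂ω₃)/5 ≡ −t_d (mod Λ)`. [folklore] -/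
theorem sum_five_eq_coreSum (α : ℤ) (hα : (α : ZMod 5) ≠ 0) (w : ℂ) :
    ∑ a : ZMod 5 × ZMod 5, Φ (a.2, a.1 + a.2) *
        (ofUpperHalfPlane UpperHalfPlane.ρ).eisensteinE₁
          (w + (α : ℂ) * (((a.1.val : ℕ) : ℂ) + ((a.2.val : ℕ) : ℂ) * QuadOrder.omega 3) / 5) =
      ∑ d : ZMod 5 × ZMod 5, Φ d *
        (ofUpperHalfPlane UpperHalfPlane.ρ).eisensteinE₁ (w - ((d.1.val : ℂ) * UpperHalfPlane.ρ + (d.2.val : ℂ)) / 5) := by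
  obtain ⟨γ, hγ⟩ : ∃ γ : ZMod 5, (α : ZMod 5) + γ = 0 := ⟨-(α : ZMod 5), add_neg_cancel _⟩
  have hγ0 : γ ≠ 0 := by
    rintro rfl
    rw [add_zero] at hγ
    exact hα hγ
  -- the reindexing bijection
  let e : ZMod 5 × ZMod 5 ≃ ZMod 5 × ZMod 5 :=
    { toFun := fun a ↦ (γ * a.2, γ * (a.1 + a.2))
      invFun := fun d ↦ (γ⁻¹ * (d.2 - d.1), γ⁻¹ * d.1)
      left_inv := fun a ↦ by
        ext
        · dsimp only
          rw [← mul_sub, ← mul_assoc, inv_mul_cancel₀ hγ0]; ring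
        · dsimp only
          rw [← mul_assoc, inv_mul_cancel₀ hγ0, one_mul]
      right_inv := fun d ↦ by
        ext
        · dsimp only
          rw [← mul_assoc, mul_inv_cancel₀ hγ0, one_mul]
        · dsimp only
          rw [← mul_add, ← mul_assoc, mul_inv_cancel₀ hγ0]; ring }
  refine Fintype.sum_equiv e _ _ fun a ↦ ?_
  have he : e a = (γ * a.2, γ * (a.1 + a.2)) := rfl
  rw [he]
  congr 1
  · -- the weight: `Φ(a₂, a₁ + a₂) = Φ(γ·(a₂, a₁ + a₂))`
    exact (phi_units_mul Φ hΦneg hΦrho hΦgen γ hγ0 (a.2, a.1 + a.2)).symm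
  · -- the point: `w + α(a₁ + a₂ω₃)/5 = (w − t_d) + (α(a₁ + a₂ω₃)/5 + t_d)`
    have hmem := fivePart_add_divPointRho_mem α γ hγ a
    rw [show w + (α : ℂ) * (((a.1.val : ℕ) : ℂ) + ((a.2.val : ℕ) : ℂ) * QuadOrder.omega 3) / 5 =
        (w - ((((γ * a.2).val : ℂ) * UpperHalfPlane.ρ + (((γ * (a.1 + a.2)).val : ℂ))) / 5)) +
          ((α : ℂ) * (((a.1.val : ℕ) : ℂ) + ((a.2.val : ℕ) : ℂ) * QuadOrder.omega 3) / 5 +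
            ((((γ * a.2).val : ℂ) * UpperHalfPlane.ρ + (((γ * (a.1 + a.2)).val : ℂ))) / 5)) by ring,
      eisensteinE₁_add_of_mem_lattice _ hmem]

end Five

/-! ## §4 The full regrouping over `𝒪₃/5M′ = 𝒪₃/5 × 𝒪₃/M′` -/

section Regroup

variable {M' : ℕ} [NeZero M']
variable {k : ℕ} (Φ : ZMod 5 × ZMod 5 → ℂ) (hΦneg : ∀ d, Φ (-d) = Φ d)
  (hΦrho : ∀ d : ZMod 5 × ZMod 5, Φ (d.2 - d.1, -d.1) = (UpperHalfPlane.ρ : ℂ) ^ k * Φ d)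
  (hΦgen : ∀ d : ZMod 5 × ZMod 5, Φ (2 * d.1 - d.2, d.1 + d.2) = (-(UpperHalfPlane.ρ : ℂ) ^ 2) ^ k * Φ d)
  (Ψ W : ℤ × ℤ → ℂ) (hΨ : ∀ y z : ℤ × ℤ, Ψ (y.1 + M' * z.1, y.2 + M' * z.2) = Ψ y)
  (hW : ∀ y : ℤ × ℤ, W y = Φ ((y.2 : ZMod 5), ((y.1 + y.2 : ℤ) : ZMod 5)) * Ψ y)
include hΦneg hΦrho hΦgen hΨ hW

/-- **CRT regrouping of the finite Eisenstein sum of `𝒪₃` modulo `5M′`.** For `(5, M′) = 1`, `αM′ + 5β = 1`, `Φ` with the unit axioms,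
`Ψ` periodic modulo `M′` and `W(y) = Φ(y₂, y₁ + y₂)Ψ(y)`:
`Σ_{c mod 5M′} W(c) E₁((c₁ + c₂ω₃)/(5M′); 𝒪₃) = Σ_{b mod M′} Ψ(b) · Σ_d Φ(d) E₁(β(b₁ + b₂ω₃)/M′ − t_d; ℤρ + ℤ)`.
[cite: Rubin1999, §7.4 Prop. 7.15] -/
theorem sum_classes_eq_sum_coreSum (hcop : Nat.Coprime 5 M') {α β : ℤ} (hαβ : α * M' + 5 * β = 1) :
    ∑ c : ZMod (5 * M') × ZMod (5 * M'),
        W ((c.1.val : ℤ), (c.2.val : ℤ)) * (QuadOrder.periodPair 3).eisensteinE₁ (QuadOrder.divPoint 3 (5 * M') c) =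
      ∑ b : ZMod M' × ZMod M', Ψ ((b.1.val : ℤ), (b.2.val : ℤ)) *
        ∑ d : ZMod 5 × ZMod 5, Φ d *
          (ofUpperHalfPlane UpperHalfPlane.ρ).eisensteinE₁
            ((β : ℂ) * (((b.1.val : ℕ) : ℂ) + ((b.2.val : ℕ) : ℂ) * QuadOrder.omega 3) / M' -
              ((d.1.val : ℂ) * UpperHalfPlane.ρ + (d.2.val : ℂ)) / 5) := by
  haveI : NeZero (5 * M') := inferInstance
  have hα : (α : ZMod 5) ≠ 0 := by
    intro h0
    have h1 : ((α * M' + 5 * β : ℤ) : ZMod 5) = 1 := by rw [hαβ, Int.cast_one]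
    push_cast at h1
    rw [h0, zero_mul, zero_add, show (5 : ZMod 5) = 0 by decide, zero_mul] at h1
    exact zero_ne_one h1
  calc ∑ c : ZMod (5 * M') × ZMod (5 * M'),
        W ((c.1.val : ℤ), (c.2.val : ℤ)) * (QuadOrder.periodPair 3).eisensteinE₁ (QuadOrder.divPoint 3 (5 * M') c)
      = ∑ p : (ZMod 5 × ZMod 5) × (ZMod M' × ZMod M'),
          Ψ ((p.2.1.val : ℤ), (p.2.2.val : ℤ)) * (Φ (p.1.2, p.1.1 + p.1.2) *
            (ofUpperHalfPlane UpperHalfPlane.ρ).eisensteinE₁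
              ((β : ℂ) * (((p.2.1.val : ℕ) : ℂ) + ((p.2.2.val : ℕ) : ℂ) * QuadOrder.omega 3) / M' +
                (α : ℂ) * (((p.1.1.val : ℕ) : ℂ) + ((p.1.2.val : ℕ) : ℂ) * QuadOrder.omega 3) / 5)) := by
        refine Fintype.sum_equiv (GaussianTheta.crtPairEquiv hcop) _ _ fun c ↦ ?_
        rw [GaussianTheta.crtPairEquiv_apply_fst, GaussianTheta.crtPairEquiv_apply_snd]
        dsimp only
        rw [hW, QuadOrder.eisensteinE₁_periodPair_three, eisensteinE₁_divPoint_eq_of_coprime hαβ c,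
          apply_natCast_eq_of_periodic Ψ hΨ c.1.val c.2.val]
        push_cast
        ring
    _ = ∑ b : ZMod M' × ZMod M', Ψ ((b.1.val : ℤ), (b.2.val : ℤ)) *
        ∑ a : ZMod 5 × ZMod 5, Φ (a.2, a.1 + a.2) *
          (ofUpperHalfPlane UpperHalfPlane.ρ).eisensteinE₁
            ((β : ℂ) * (((b.1.val : ℕ) : ℂ) + ((b.2.val : ℕ) : ℂ) * QuadOrder.omega 3) / M' +
              (α : ℂ) * (((a.1.val : ℕ) : ℂ) + ((a.2.val : ℕ) : ℂ) * QuadOrder.omega 3) / 5) := by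
        rw [Fintype.sum_prod_type, Finset.sum_comm]
        refine Finset.sum_congr rfl fun b _ ↦ ?_
        rw [Finset.mul_sum]
    _ = _ := by
        refine Finset.sum_congr rfl fun b _ ↦ ?_
        rw [sum_five_eq_coreSum Φ hΦneg hΦrho hΦgen α hα]

end Regroup

/-! ## §5 ★ The `5`-integrality of the finite Eisenstein sum from the CM core -/

section Integral

variable {M' : ℕ} [NeZero M']

/-- `M′ · (β(b₁ + b₂ω₃)/M′) ∈ ℤρ + ℤ`. [folklore] -/
theorem natCast_mul_wb_mem (β : ℤ) (b : ZMod M' × ZMod M') :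
    (M' : ℂ) * ((β : ℂ) * (((b.1.val : ℕ) : ℂ) + ((b.2.val : ℕ) : ℂ) * QuadOrder.omega 3) / M') ∈
      (ofUpperHalfPlane UpperHalfPlane.ρ).lattice := by
  have hM : (M' : ℂ) ≠ 0 := Nat.cast_ne_zero.mpr (NeZero.ne M')
  rw [mul_div_cancel₀ _ hM, mul_add, ← mul_assoc]
  have h := intCast_add_intCast_mul_omega_mem (β * b.1.val) (β * b.2.val)
  push_cast at h
  exact h

variable {k : ℕ} (Φ : ZMod 5 × ZMod 5 → ℂ) (hΦ0 : Φ 0 = 0) (hΦone : Φ (0, 1) = 1) (hΦneg : ∀ d, Φ (-d) = Φ d)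
  (hΦrho : ∀ d : ZMod 5 × ZMod 5, Φ (d.2 - d.1, -d.1) = (UpperHalfPlane.ρ : ℂ) ^ k * Φ d)
  (hΦgen : ∀ d : ZMod 5 × ZMod 5, Φ (2 * d.1 - d.2, d.1 + d.2) = (-(UpperHalfPlane.ρ : ℂ) ^ 2) ^ k * Φ d)
  (Ψ W : ℤ × ℤ → ℂ) (hΨ : ∀ y z : ℤ × ℤ, Ψ (y.1 + M' * z.1, y.2 + M' * z.2) = Ψ y)
  (hΨint : ∀ y : ℤ × ℤ, IsIntegral ℤ (Ψ y))
  (hW : ∀ y : ℤ × ℤ, W y = Φ ((y.2 : ZMod 5), ((y.1 + y.2 : ℤ) : ZMod 5)) * Ψ y)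
include hΦ0 hΦone hΦneg hΦrho hΦgen hΨ hΨint hW

/-- ★ **The finite Eisenstein–Kronecker sum of `𝒪₃` modulo `5M′` with weight `Φ ⊗ Ψ` is `5`-integral after division by
`ϖ₁ · 5^{(6−k)/6}`.** `Φ : (ℤ/5)² → ℂ` with the five axioms of `(·/5)₆^k` (`1 ≤ k ≤ 5`), `(5, M′) = 1`, `Ψ` periodic modulo `M′` with
algebraic-integer values, `W(y) = Φ(y₂, y₁ + y₂)Ψ(y)`: there is `s ∈ ℕ`, `5 ∤ s`, with
`s · (Σ_{c mod 5M′} W(c) E₁((c₁ + c₂ω₃)/(5M′); 𝒪₃)) / (ϖ₁ · 5^{(6−k)/6}) ∈ ℤ̄`, `ϖ₁ = 2^{2/3}Γ(1/3)³/(4π)` — §4 and, for each `b mod M′`,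
bed-w1 g8's `core_rho_of_character` at `w_b = β(b₁ + b₂ω₃)/M′`. [cite: Rubin1999, §7.4 Prop. 7.12, Prop. 7.15] [cite: Serre1979, Ch. IV §2 Prop. 7] -/
theorem sum_classes_integral_of_character (hk1 : 1 ≤ k) (hk5 : k ≤ 5) (hcop : Nat.Coprime 5 M') :
    ∃ s : ℕ, ¬ 5 ∣ s ∧ IsIntegral ℤ ((s : ℂ) *
      (∑ c : ZMod (5 * M') × ZMod (5 * M'),
        W ((c.1.val : ℤ), (c.2.val : ℤ)) * (QuadOrder.periodPair 3).eisensteinE₁ (QuadOrder.divPoint 3 (5 * M') c)) /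
      ((((2 : ℝ) ^ (2 / 3 : ℝ) * Real.Gamma (1 / 3) ^ 3 / (4 * Real.pi) : ℝ) : ℂ) * (5 : ℂ) ^ (((6 - k : ℕ) : ℂ) / 6))) := by
  -- Bezout for `(5, M')`
  obtain ⟨α, β, hαβ⟩ : ∃ α β : ℤ, α * M' + 5 * β = 1 := by
    have hcopZ : IsCoprime (M' : ℤ) (5 : ℤ) := by
      rw [Int.isCoprime_iff_gcd_eq_one, show (5 : ℤ) = ((5 : ℕ) : ℤ) by rfl, Int.gcd_natCast_natCast]; exact hcop.symm
    obtain ⟨u, v, huv⟩ := hcopZ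
    exact ⟨u, v, by linear_combination huv⟩
  rw [sum_classes_eq_sum_coreSum Φ hΦneg hΦrho hΦgen Ψ W hΨ hW hcop hαβ]
  exact sum_integral_of_termwise (by norm_num : (5 : ℕ).Prime) (fun b : ZMod M' × ZMod M' ↦ Ψ ((b.1.val : ℤ), (b.2.val : ℤ)))
    _ _ (fun b ↦ hΨint _)
    (fun b ↦ core_rho_of_character hk1 hk5 Φ hΦ0 hΦone hΦneg hΦrho hΦgen M' hcop.symm _ (natCast_mul_wb_mem β b))

end Integral

end Summit.BirchSwinnertonDyer.BirchSwinnertonDyer.Theorems.BiquadraticEisensteinDescentManinDatumSupercuspidalCMInertThetaValueAssemblyJZero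

end
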